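import Summits.ABC.IUTFork.Repair.CandJoshi34
import Summits.ABC.IUTFork.Repair.CandDupuyHilado32
import HarnessLib

/-!
# IUT REPAIR branch, sub-cell B3 (Joshi) — candidate 34, cross cells: the COV bed EXITS the Dupuy–Hilado orbit barrier, by COVERING

Proof-only evaluation file (D-0012; no definition, no `Prop` fact, nothing asserted about print) of the abc-iut cell's IUT REPAIR branch B
(rung LADDER-ABC:A2.RP ⊆ A2.B), seat abc-iut-rp-j3 gen 3; sequel of `Repair/CandJoshi34` (the J-cells at the honest orbit-COVERING bed COV,
`Cor312OrbitCovering{Shells,Lattices,Volumes,Model,Witness}`). TAKES NO SIDE on [IUTchIII] Cor. 3.12 or on any author (Mochizuki / Scholze–Stix /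
Joshi / Dupuy–Hilado); candidates are hypotheses; typed ≠ proved; instantiated ≠ endorsed.

CROSS CELLS (by name, for abc-iut-rp-h3's B4 rows RP-H32 / RP-H33 and the branch's PROFILE table):
* **`not_orbitInside_cov` — COV lies OUTSIDE rp-h3's barrier class `CandDupuyHilado32.OrbitInside`**: the first-factor `SL₂(ℤ)`-element with rows
  `(0, −1)`, `(1, 0)` (the coordinate ROTATION of the rank-2 carrier) carries the Θ-lattice point `p·e_{(1,0,0)}` to `−p·e_{(0,0,0)}`, which lies
  outside the Θ-lattice (depth `25` is required on the all-zero coordinate) — `cov_excursion`. By rp-h3's `orbit_excursion_of_statement` every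
  DH-faithful model of the Statement must leave the class; rp-h3's EXC bed P♮ₑ leaves it by an EXCURSION whose HULL inflates (Licence ✗), COV
  leaves it by excursions whose UNION COVERS the q-region (Licence ✓): the two honest exits of record.
* `cov_vs_exc` — the two exits side by side in one line: at COV the Licence HOLDS and `S` fails; (EXC's `¬Licence` is rp-h3's
  `ExcursionWitness.excSetting_not_licence`, cited, not restated).
READING (neutral): inside `OrbitInside` the hull collapses onto the Θ-polydisc and the Statement fails on honest data (rp-h3, p437377); outside it,
the tree now holds BOTH ways the printed inequality can arise honestly at interface level — hull inflation over a non-covering orbit (EXC, strict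
inequality, Licence false) and orbit-UNION covering (COV, equality, Licence true). Neither realises `S`. Which, if either, [IUTchI] Def. 3.1 data
realise is not modelled. Standard axioms only. [claim: Mochizuki2012, status: disputed] [cite: DupuyHilado2020, §6.2] [claim: Joshi2021ATSII, status: disputed]
-/

noncomputable section

open Set

namespace Summit.ABC.IUTFork.Repair.CandJoshi34

open Thm311 Cor312 Cor312.Checks Cor312Vol Cor312Vol.CoveringWitness Literature.IUT.LogThetaLattice

variable (p : ℕ) [hp : Fact p.Prime]

/-! ## 3. COV exits the orbit barrier -/

/-- The coordinate ROTATION `(x₀, x₁) ↦ (−x₁, x₀)` of the rank-2 carrier: rows `(0, −1)`, `(1, 0)`, determinant `1`. [folklore] -/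
theorem rot_det : (0 : ℤ) * 0 - (-1) * 1 = 1 := by norm_num

/-- **THE EXCURSION at COV**: at label `j = 2` the (Ind2)-family «rotation on the first tensor factor» carries the Θ-lattice point `p·e_{(1,0,0)}` OUT of
the Θ-lattice (its image has all-zero coordinate `−p`, of depth `1 < 25`). [folklore] -/
theorem cov_excursion (vQ : toyIndex.VQ) :
    firstFam (intAut 0 (-1) 1 0 rot_det) ∈ covGroup ∧
      ((p : ℚ) ^ 1) • ePt (Setting.labelSucc (T := toyIndex) ⟨1, PinnedWitness.one_lt_lstar⟩) vQ (Function.update (czero _) 0 1) ∈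
        thetaLat p (Setting.labelSucc (T := toyIndex) ⟨1, PinnedWitness.one_lt_lstar⟩) vQ ∧
      firstFam (intAut 0 (-1) 1 0 rot_det) _ vQ
          (((p : ℚ) ^ 1) • ePt (Setting.labelSucc (T := toyIndex) ⟨1, PinnedWitness.one_lt_lstar⟩) vQ (Function.update (czero _) 0 1)) ∉
        thetaLat p (Setting.labelSucc (T := toyIndex) ⟨1, PinnedWitness.one_lt_lstar⟩) vQ := by
  have hj : (Setting.labelSucc (T := toyIndex) ⟨1, PinnedWitness.one_lt_lstar⟩) ≠ 0 := Setting.labelSucc_ne_zero _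
  refine ⟨firstFam_mem_closure (intAut_mem_latAuts 0 (-1) 1 0 rot_det), ?_, ?_⟩
  · exact (pow_smul_ePt_mem_glat_iff p vQ _ _ 1).2 (by rw [thetaDepth_update]; unfold qDepth; rw [if_neg hj])
  · intro h
    have h0 := h (czero _)
    rw [coord_firstFam, Fin.sum_univ_two, update_czero_zero, coord_smul_ePt, coord_smul_ePt, if_neg, if_pos rfl,
      show czero (Setting.labelSucc (T := toyIndex) ⟨1, PinnedWitness.one_lt_lstar⟩) 0 = 0 from rfl, ent_intAut_zero, ent_intAut_zero, if_pos rfl,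
      if_neg (by decide)] at h0
    · have h1 : InDepth p 2 ((p : ℚ) ^ 1) := by
        have h25 : 2 ≤ thetaDepth (Setting.labelSucc (T := toyIndex) ⟨1, PinnedWitness.one_lt_lstar⟩) (czero _) := by
          unfold thetaDepth; rw [if_neg hj, if_pos rfl]; norm_num [Setting.labelSucc]
        obtain ⟨n, hn⟩ := h0.mono h25
        refine ⟨-n, ?_⟩
        push_cast at hn ⊢
        linear_combination -hn
      exact absurd ((inDepth_pow_iff p 2 1).1 h1) (by norm_num)
    · intro hc
      have := congrFun hc 0
      rw [Function.update_self] at this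
      exact absurd this.symm (by decide)

/-- **COV lies OUTSIDE rp-h3's barrier class `OrbitInside`** (RP-H32): some indeterminacy moves the (Ind3)-region out of the Θ-pilot's `m = 0`
Kummer image at `j = 2`. [folklore] -/
theorem not_orbitInside_cov : ¬ CandDupuyHilado32.OrbitInside (covFull p).toLatticeSituation (covSetting p) := by
  intro h
  obtain ⟨hΦ, hx, hnot⟩ := cov_excursion p ()
  have hsub := h _ hΦ ⟨1, PinnedWitness.one_lt_lstar⟩ ()
  rw [covSetting_thetaRegion3, covSetting_thetaRegion] at hsub
  exact hnot (hsub ⟨_, hx, rfl⟩)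

/-- **The two honest exits from the orbit barrier, COV's side**: outside `OrbitInside`, with the Statement, the (xi-f) Licence TRUE (the union of
the possible images covers the q-region) and `S` FALSE — to be read next to rp-h3's EXC (`ExcursionWitness.excSetting_not_licence`: Statement
strict, Licence FALSE). [folklore] -/
theorem cov_vs_exc :
    ¬ CandDupuyHilado32.OrbitInside (covFull p).toLatticeSituation (covSetting p) ∧ (covSetting p).Statement ∧
      Thm311ToCor312.Licence (covSetting p) ∧ ¬ PilotKummerIndRelated (covFull p).toLatticeSituation (covSetting p) (rho p) (covQK p) :=
  ⟨not_orbitInside_cov p, covSetting_statement p, cov_licence p, covSetting_not_pilotKummerIndRelated p⟩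

end Summit.ABC.IUTFork.Repair.CandJoshi34

end
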